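import Summits.SmoothPoincare4.SmoothPoincare4.Theorems.EntropyRungChangGurskyYangStubRoundnessRateAux
import Summits.SmoothPoincare4.SmoothPoincare4.Theorems.EntropyRungChangGurskyYangStubRoundnessRateAux2
import HarnessLib

/-!
# Type-I bounds and the roundness rate of a pinched maximal Ricci flow
(stub `stub_roundnessRate` of line `margerin-cone-hamilton-rails`, crux `EntropyRung.ChangGurskyYang`,
item stmt-SmoothPoincare4-10834)

Step 4.B3 of STUB 4 (`stub_pinchedFlowConvergence` = Hamilton 1986, §5.2 convergence criterion) of
the line: Hamilton 1982, §16 and Lemma 17.2 / Cor. 17.3 / Cor. 17.5 in UNnormalised clothes — once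
`R_max/R_min → 1`, the flow is Type I and becomes round at a power rate. For a maximal Ricci flow
`(g, cov)` on `[0, T)` on a closed connected 4-manifold with the invariant pinching `m ≤ R`,
`|W|² + 2|E|² ≤ K R^{2−τ}` (`0 < τ ≤ 1`), GIVEN the gradient-decay estimate (Hamilton's Lemma 17.4,
the output (ii) of STUB 4.B1) and the ratio bound `R ≥ θ R_max` at late times for every `θ < 1`
(STUB 4.B2), there are `δ > 0`, `C ≥ 0`, `t₀ ∈ [0, T)` with, for `t ∈ [t₀, T)` and all `x`:
`|(T−t)R − 2| ≤ C(T−t)^δ`, `(T−t)²|E|² ≤ C(T−t)^{2δ}`, `(T−t)²|W|² ≤ C(T−t)^δ`,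
`|Rm|² ≤ C(T−t)^{−2}` — in the dictionary `R = scalarCurvatureWith (cov t)`,
`|E|² = normSq Ric − R²/4`, `|W|² = curvNormSqWith − 2 normSq Ric + R²/3`.

## Proof (fact-free; the two halves are the registered helpers of the Aux files)

* `helper_roundnessTypeOne` (`…StubRoundnessRateAux.lean`): at late times `1 ≤ (T−t)R ≤ 3`,
  `K R^{−τ} ≤ 1/20`, `R_min(t)(T−t) ≤ 2` (Topping's Cor. 3.2.4 restarted at `t`), and
  `R_max(t)(T−t) ≥ 1/a` whenever `2|Ric|² ≤ aR²` on `[t, T)` (weak maximum principle for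
  `∂ₜR = ΔR + 2|Ric|²` + curvature blow-up at the maximal time).
* the decay hypothesis with `c₁ = 1`, `c₂ = 3`: `|∇R|² ≤ C₁(T−t)^{δ₁−3}` on `[t₁, T)`.
* `helper_roundnessOscillation` (`…StubRoundnessRateAux2.lean`): `Ric ≥ (R/12)g ≥ g/(12(T−t))`
  from the pinching, Myers' diameter bound and the gradient bound along minimizing geodesics give
  `(T−t)|R(x) − R(y)| ≤ C₂(T−t)^{δ₁/2}`, `C₂ = 6π√(max C₁ 0)`.
* assembly, with `h = T − t ≤ 1` and `R^{−τ} ≤ h^τ`: `2|Ric|² ≤ (1/2 + Kh^τ)R²` on `[t, T)`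
  gives `hR_max ≥ 2/(1 + 2Kh^τ) ≥ 2 − 4Kh^τ`; so `2 − 4Kh^τ − C₂h^{δ₁/2} ≤ hR ≤ 2 + C₂h^{δ₁/2}`;
  `h²·2|E|² ≤ h²KR^{2−τ} = KR^{−τ}(hR)² ≤ 9Kh^τ`, `h²|W|² ≤ 9Kh^τ`, `h²|Rm|² ≤ 9Kh^τ + 3/2`;
  `δ = min(τ/2, δ₁/2)`, `C = 13K + C₂ + 3/2`.

## References

* R. S. Hamilton, *Three-manifolds with positive Ricci curvature*, J. Differential Geom. 17
  (1982) 255–306, §16 Lemmas 16.1–16.5, §17 Lemma 17.2, Cor. 17.3, Lemma 17.4, Cor. 17.5.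
  [Hamilton1982]
* R. S. Hamilton, *Four-manifolds with positive curvature operator*, J. Differential Geom. 24
  (1986) 153–179, §5, 5.2 (p. 164). [Hamilton1986]
* G. Huisken, *Ricci deformation of the metric on a Riemannian manifold*, J. Differential
  Geom. 21 (1985) 47–62, §5. [Huisken1985]
-/

noncomputable section

-- every `Summit.SmoothPoincare4.SmoothPoincare4.…` name repeats the summit = sub-problem segment (D-0017 layout)
set_option linter.dupNamespace false

open Set Function Filter
open scoped Manifold ContDiff Topology

namespace Summit.SmoothPoincare4.SmoothPoincare4.Theorems.MargerinRails

open Literature.Geometry.Riemannian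
open Literature.Geometry.Lorentzian Literature.Geometry.Lorentzian.PseudoRiemannianMetric

/-- **STUB 4.B3 — TYPE-I BOUNDS AND THE ROUNDNESS RATE (Hamilton 1982, §16 with Lemma 17.2/Cor. 17.3/17.5,
in unnormalised clothes).** For the maximal pinched flow with `R_max/R_min → 1` (STUB 4.B2 output) and the
decay estimate (ii) of STUB 4.B1: at late times `|(T−t)R − 2| ≤ C(T−t)^δ`, `(T−t)²|E|² ≤ C(T−t)^{2δ}`,
`(T−t)²|W|² ≤ C(T−t)^δ` and `|Rm|² ≤ C(T−t)^{−2}`. Proof: the Type-I sandwich `1 ≤ (T−t)R ≤ 3`,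
`K R^{−τ} ≤ 1/20`, `R_min(T−t) ≤ 2` and `R_max(T−t) ≥ 1/a` whenever `2|Ric|² ≤ aR²` on `[t, T)`
(`helper_roundnessTypeOne`); the decay hypothesis with `c₁ = 1`, `c₂ = 3` and the oscillation bound
`(T−t)(R_max − R_min) ≤ C₂(T−t)^{δ₁/2}` (`helper_roundnessOscillation`); then with `h = T − t ≤ 1`,
`R^{−τ} ≤ h^τ`: `2|Ric|² ≤ (1/2 + Kh^τ)R²` on `[t, T)` gives `hR_max ≥ 2 − 4Kh^τ`, so
`2 − 4Kh^τ − C₂h^{δ₁/2} ≤ hR ≤ 2 + C₂h^{δ₁/2}`; `h²·2|E|² ≤ h²KR^{2−τ} ≤ 9Kh^τ`, `h²|W|² ≤ 9Kh^τ`,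
`h²|Rm|² ≤ 9Kh^τ + 3/2`; finally `δ = min(τ/2, δ₁/2)`, `C = 13K + C₂ + 3/2`.
[cite: Hamilton1982, §16, Lemmas 16.1–16.5; §17, Lemma 17.2, Cor. 17.3, Cor. 17.5] [cite: Huisken1985, §5] -/
theorem stub_roundnessRate :
    ∀ (M : Type) [TopologicalSpace M] [T2Space M] [SecondCountableTopology M]
      [ChartedSpace (EuclideanSpace ℝ (Fin 4)) M] [IsManifold (𝓡 4) ∞ M] [CompactSpace M]
      [ConnectedSpace M]
      (g : ℝ → PseudoRiemannianMetric (𝓡 4) ∞ (EuclideanSpace ℝ (Fin 4)) (TangentSpace (𝓡 4) : M → Type _))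
      (cov : ℝ → CovariantDerivative (𝓡 4) (EuclideanSpace ℝ (Fin 4)) (TangentSpace (𝓡 4) : M → Type _))
      (T m K τ : ℝ), 0 < m → 0 < K → 0 < τ → τ ≤ 1 →
      IsMaximalRicciFlow g cov T →
      (∀ t ∈ Ico 0 T, ∀ [(g t).HasLeviCivita] (x : M),
        m ≤ (g t).scalarCurvature x ∧
          (g t).weylNormSq x + 2 * (g t).tracelessRicciNormSq x ≤
            K * (g t).scalarCurvature x ^ (2 - τ)) →
      (∀ (t₁ c₁ c₂ : ℝ), t₁ ∈ Ico 0 T → 0 < c₁ →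
        (∀ t ∈ Ico t₁ T, ∀ x : M, c₁ ≤ (T - t) * (g t).scalarCurvatureWith (cov t) x ∧
          (T - t) * (g t).scalarCurvatureWith (cov t) x ≤ c₂) →
        ∃ δ C : ℝ, 0 < δ ∧ ∀ t ∈ Ico t₁ T, ∀ x : M,
          (g t).gradSq (fun y ↦ (g t).scalarCurvatureWith (cov t) y) x ≤ C * (T - t) ^ (δ - 3)) →
      (∀ θ : ℝ, 0 < θ → θ < 1 → ∃ t₀ ∈ Ico 0 T, ∀ t ∈ Ico t₀ T, ∀ x y : M,
        θ * (g t).scalarCurvatureWith (cov t) y ≤ (g t).scalarCurvatureWith (cov t) x) →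
      ∃ δ C t₀ : ℝ, 0 < δ ∧ 0 ≤ C ∧ t₀ ∈ Ico 0 T ∧ ∀ t ∈ Ico t₀ T, ∀ x : M,
        |(T - t) * (g t).scalarCurvatureWith (cov t) x - 2| ≤ C * (T - t) ^ δ ∧
        (T - t) ^ 2 * ((g t).normSq x ((cov t).ricci x) -
            (g t).scalarCurvatureWith (cov t) x ^ 2 / 4) ≤ C * (T - t) ^ (2 * δ) ∧
        (T - t) ^ 2 * ((g t).curvNormSqWith (cov t) x - 2 * (g t).normSq x ((cov t).ricci x) +
            (g t).scalarCurvatureWith (cov t) x ^ 2 / 3) ≤ C * (T - t) ^ δ ∧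
        (g t).curvNormSqWith (cov t) x ≤ C * ((T - t) ^ 2)⁻¹ := by
  intro M _ _ _ _ _ _ _ g cov T m K τ hm hK hτ0 hτ1 hmax hpinch hdecay hratio
  have hflow := hmax.isRicciFlow
  have hRiem := hmax.isRiemannian
  -- the Type-I sandwich, the gradient decay with `c₁ = 1`, `c₂ = 3`, the oscillation bound
  obtain ⟨t₁, ht₁, htype⟩ :=
    helper_roundnessTypeOne M g cov T m K τ hm hK hτ0 hmax hpinch hratio
  obtain ⟨δ₁, C₁, hδ₁, hgrad⟩ := hdecay t₁ 1 3 ht₁ one_pos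
    (fun t ht x ↦ ⟨((htype t ht).1 x).1, ((htype t ht).1 x).2.1⟩)
  have hosc := helper_roundnessOscillation M g cov T m K τ t₁ C₁ δ₁ hm hflow hRiem hpinch ht₁
    (fun t ht x ↦ ⟨((htype t ht).1 x).1, ((htype t ht).1 x).2.2⟩) hgrad
  clear hdecay hratio hgrad
  -- the constants
  set C₂ := 6 * Real.pi * Real.sqrt (max C₁ 0) with hC₂
  have hC₂0 : 0 ≤ C₂ := by positivity
  refine ⟨min (τ / 2) (δ₁ / 2), 13 * K + C₂ + 3 / 2, max t₁ (T - 1), lt_min (by linarith) (by linarith),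
    by positivity, ⟨le_max_of_le_left ht₁.1, max_lt ht₁.2 (by linarith)⟩, fun t ht x ↦ ?_⟩
  have hδτ : min (τ / 2) (δ₁ / 2) ≤ τ / 2 := min_le_left _ _
  have hδδ₁ : min (τ / 2) (δ₁ / 2) ≤ δ₁ / 2 := min_le_right _ _
  generalize min (τ / 2) (δ₁ / 2) = δ at hδτ hδδ₁ ⊢
  have ht₁t : t ∈ Ico t₁ T := ⟨(le_max_left _ _).trans ht.1, ht.2⟩
  have ht' : t ∈ Ico 0 T := ⟨ht₁.1.trans ht₁t.1, ht.2⟩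
  have hT1 : T - 1 ≤ t := (le_max_right _ _).trans ht.1
  have hh0 : 0 < T - t := sub_pos.2 ht.2
  obtain ⟨hall, hlow, ⟨x₁, hx₁⟩⟩ := htype t ht₁t
  -- `R^{-τ} ≤ (T - s)^τ ≤ (T - t)^τ` on `[t, T)`, from `(T - s) R ≥ 1`
  have hRτ : ∀ s ∈ Ico t T, ∀ y : M,
      (g s).scalarCurvatureWith (cov s) y ^ (-τ) ≤ (T - t) ^ τ := by
    intro s hs y
    obtain ⟨h1, -, -⟩ := (htype s ⟨ht₁t.1.trans hs.1, hs.2⟩).1 y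
    have hTs : 0 < T - s := sub_pos.2 hs.2
    have hinv : (T - s)⁻¹ ≤ (g s).scalarCurvatureWith (cov s) y := by
      rw [inv_le_iff_one_le_mul₀' hTs]; exact h1
    calc (g s).scalarCurvatureWith (cov s) y ^ (-τ) ≤ (T - s)⁻¹ ^ (-τ) :=
          Real.rpow_le_rpow_of_nonpos (inv_pos.2 hTs) hinv (by linarith)
      _ = (T - s) ^ τ := by rw [Real.inv_rpow hTs.le, Real.rpow_neg hTs.le, inv_inv]
      _ ≤ (T - t) ^ τ := Real.rpow_le_rpow hTs.le (by linarith [hs.1]) hτ0.le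
  -- the lower bound on `R_max(t)`: `2|Ric|² ≤ (1/2 + K (T-t)^τ) R²` on `[t, T)`
  have hRic : ∀ s ∈ Ico t T, ∀ y : M, 2 * (g s).normSq y ((cov s).ricci y) ≤
      (1 / 2 + K * (T - t) ^ τ) * (g s).scalarCurvatureWith (cov s) y ^ 2 := by
    intro s hs y
    obtain ⟨hmR', -, hWnn', hp'⟩ :=
      roundness_dictionary hflow hRiem hpinch ⟨ht'.1.trans hs.1, hs.2⟩ y
    have hR0' : 0 < (g s).scalarCurvatureWith (cov s) y := hm.trans_le hmR'
    have hle : K * (g s).scalarCurvatureWith (cov s) y ^ (2 - τ) ≤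
        K * (T - t) ^ τ * (g s).scalarCurvatureWith (cov s) y ^ 2 :=
      calc K * (g s).scalarCurvatureWith (cov s) y ^ (2 - τ)
          = K * (g s).scalarCurvatureWith (cov s) y ^ (-τ) *
              (g s).scalarCurvatureWith (cov s) y ^ 2 := by
            rw [sub_eq_add_neg, Real.rpow_add hR0', Real.rpow_two]; ring
        _ ≤ K * (T - t) ^ τ * (g s).scalarCurvatureWith (cov s) y ^ 2 :=
            mul_le_mul_of_nonneg_right (mul_le_mul_of_nonneg_left (hRτ s hs y) hK.le)
              (sq_nonneg _)
    linarith
  obtain ⟨x₂, hx₂⟩ := hlow (1 / 2 + K * (T - t) ^ τ) (by positivity) hRic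
  -- the facts at time `t`
  obtain ⟨h1R, h3R, -⟩ := hall x
  obtain ⟨h1x₂, -, -⟩ := hall x₂
  obtain ⟨hmR, hEnn, hWnn, hp⟩ := roundness_dictionary hflow hRiem hpinch ht' x
  have hRτx := hRτ t ⟨le_rfl, ht.2⟩ x
  have hosc₁ : (T - t) * |(g t).scalarCurvatureWith (cov t) x -
      (g t).scalarCurvatureWith (cov t) x₁| ≤ C₂ * (T - t) ^ (δ₁ / 2) := hosc t ht₁t x x₁
  have hosc₂ : (T - t) * |(g t).scalarCurvatureWith (cov t) x₂ -
      (g t).scalarCurvatureWith (cov t) x| ≤ C₂ * (T - t) ^ (δ₁ / 2) := hosc t ht₁t x₂ x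
  clear hRτ hRic hlow hall htype hosc hpinch hflow hRiem hmax
  rw [← abs_of_pos hh0, ← abs_mul, abs_of_pos hh0, mul_sub, abs_sub_le_iff] at hosc₁ hosc₂
  -- abbreviations
  set h := T - t with hh
  have hh1 : h ≤ 1 := by rw [hh]; linarith
  set R := (g t).scalarCurvatureWith (cov t) x with hR
  set R₁ := (g t).scalarCurvatureWith (cov t) x₁ with hR₁
  set R₂ := (g t).scalarCurvatureWith (cov t) x₂ with hR₂
  set N := (g t).normSq x ((cov t).ricci x) with hN
  set Q := (g t).curvNormSqWith (cov t) x with hQ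
  have hR0 : 0 < R := hm.trans_le hmR
  -- powers of `h ∈ (0, 1]`
  have hpow : ∀ a b : ℝ, b ≤ a → h ^ a ≤ h ^ b := fun a b hab ↦
    Real.rpow_le_rpow_of_exponent_ge hh0 hh1 hab
  have hhτ1 : h ^ τ ≤ 1 := Real.rpow_le_one hh0.le hh1 hτ0.le
  have hhτ0 : 0 ≤ h ^ τ := Real.rpow_nonneg hh0.le _
  have hhδ : 0 ≤ h ^ δ := Real.rpow_nonneg hh0.le _
  have hh2δ : 0 ≤ h ^ (2 * δ) := Real.rpow_nonneg hh0.le _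
  have hKδ : K * h ^ τ ≤ K * h ^ δ := mul_le_mul_of_nonneg_left (hpow _ _ (by linarith)) hK.le
  have hK2δ : K * h ^ τ ≤ K * h ^ (2 * δ) :=
    mul_le_mul_of_nonneg_left (hpow _ _ (by linarith)) hK.le
  have hC₂δ : C₂ * h ^ (δ₁ / 2) ≤ C₂ * h ^ δ := mul_le_mul_of_nonneg_left (hpow _ _ hδδ₁) hC₂0
  have hKh1 : K * h ^ τ ≤ K := by simpa using mul_le_mul_of_nonneg_left hhτ1 hK.le
  have hKhδ : 0 ≤ K * h ^ δ := mul_nonneg hK.le hhδ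
  have hKh2δ : 0 ≤ K * h ^ (2 * δ) := mul_nonneg hK.le hh2δ
  have hC₂hδ : 0 ≤ C₂ * h ^ δ := mul_nonneg hC₂0 hhδ
  have hC₂h2δ : 0 ≤ C₂ * h ^ (2 * δ) := mul_nonneg hC₂0 hh2δ
  have hh2 : 0 ≤ h ^ 2 := sq_nonneg h
  have hhR : (h * R) ^ 2 ≤ 9 := (pow_le_pow_left₀ (by linarith) h3R 2).trans (by norm_num)
  -- `h² K R^{2-τ} ≤ 9 K h^τ`
  have hKR2 : h ^ 2 * (K * R ^ (2 - τ)) ≤ 9 * K * h ^ τ :=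
    calc h ^ 2 * (K * R ^ (2 - τ)) = K * R ^ (-τ) * (h * R) ^ 2 := by
          rw [sub_eq_add_neg, Real.rpow_add hR0, Real.rpow_two]; ring
      _ ≤ K * h ^ τ * 9 :=
          mul_le_mul (mul_le_mul_of_nonneg_left hRτx hK.le) hhR (sq_nonneg _) (by positivity)
      _ = 9 * K * h ^ τ := by ring
  -- `h R_max ≥ 2 - 4 K h^τ`
  have hmax2 : 2 - 4 * (K * h ^ τ) ≤ h * R₂ := by
    by_cases hX2 : h * R₂ ≤ 2
    · have := mul_le_mul_of_nonneg_left hX2 (mul_nonneg hK.le hhτ0)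
      linarith
    · push Not at hX2
      linarith [mul_nonneg hK.le hhτ0]
  have hx₁' : h * R₁ ≤ 2 := hx₁
  refine ⟨?_, ?_, ?_, ?_⟩
  · -- `|hR - 2| ≤ C h^δ`
    rw [abs_sub_le_iff]
    constructor <;> linarith [hosc₁.1, hosc₂.1]
  · -- `h² |E|² ≤ C h^{2δ}`
    have hE2 : N - R ^ 2 / 4 ≤ K * R ^ (2 - τ) / 2 := by linarith
    have := mul_le_mul_of_nonneg_left hE2 hh2
    linarith
  · -- `h² |W|² ≤ C h^δ`
    have hW2 : Q - 2 * N + R ^ 2 / 3 ≤ K * R ^ (2 - τ) := by linarith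
    have := mul_le_mul_of_nonneg_left hW2 hh2
    linarith
  · -- `|Rm|² ≤ C h^{-2}`
    rw [← div_eq_mul_inv, le_div_iff₀ (pow_pos hh0 2)]
    have e : Q * h ^ 2 = h ^ 2 * ((Q - 2 * N + R ^ 2 / 3) + 2 * (N - R ^ 2 / 4)) +
        (h * R) ^ 2 / 6 := by ring
    rw [e]
    have := mul_le_mul_of_nonneg_left hp hh2
    linarith

end Summit.SmoothPoincare4.SmoothPoincare4.Theorems.MargerinRails

end
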